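import Summits.CriticalPhenomena.PercolationContinuityZ3.Theorems.PercNearOneGluingNoHeavyQuantFarGate3Assembly
import Summits.CriticalPhenomena.PercolationContinuityZ3.Theorems.PercNearOneGluingNoHeavyQuantFarGate3CrowdPlusArith
import HarnessLib

/-!
# QUANT lane R8, front "FAR beyond trees", layer one — THE DEGREE-THREE GATE AT THE OBSERVER, XXIb: the CROWD-PLUS regime on every graph (outside cuts + the two u-cuts, constant weights)

builds on p205010 (kernel theorem, internal audit signed; external expert review pending)

Support file (`--supports stmt-CriticalPhenomena-4575`), seat `prim-quant-p1` (gen 29); memo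
`run/shared/lean/prim/quant/prim-quant-p1-g29/FOR-LEAD-GATE3-BAND.md` §2 (extends g28's memo §6c).  Standard axioms; no sorries; no definitions.

**The crowd-plus regime** (generalized item with price `1/(λ₁+λ₂+n)` and weights on the two `u`-cuts; no mean hypothesis, no Harris).
With `n = |A ∖ {v,u₁,u₂}|`, the outside cuts give `n(1−t) ≤ S ≤ Σ_c sub_c·x_c` (files VII–X) and the `u`-cuts give `1 − t ≤ q_i = Σ_c ψ_{i,c} x_c`;
if reals `λ₁, λ₂ ≥ 0` satisfy CELLWISE `λ₁ψ_{1,c} + λ₂ψ_{2,c} + sub_c ≤ (λ₁+λ₂+n)·φ_c`, then `(λ₁+λ₂+n)(1−t) ≤ (λ₁+λ₂+n)·P(N ≥ 2)`, i.e. the row.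
Only four cells constrain `(λ₁, λ₂)`: `a1`: `1 − p·r̄ − n·p(1−r̄) ≤ p(λ₁(1−r₁) + λ₂(1−r₂))`; `c1`: `1 − p(1−W₁₂) − n·pW₁₂ ≤ pW₁₂(λ₁+λ₂)`;
`b10`: `λ₁(1−p)(1−r₁) ≤ (1−r₂)s₁(λ₂+n)`; `b20`: `λ₂(1−p)(1−r₂) ≤ (1−r₁)s₂(λ₁+n)` (`s_i = 1−(1−p)(1−r_i)`, `W₁₂ = (1−r₁)(1−r₂)`, `r̄ = max r`).
`λ₁ = λ₂ = 0` is file XIV (crowd).  The feasible `(λ₁,λ₂)` form a polygon whose componentwise-maximal vertex is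
`λ_i* = n·s_i·m_i/((1−r_i)Δ) − n`... (memo §2: closed form `(A*) p·n(s₁m₁+s₂m₂) ≥ (1−p r̄−np(1−r̄))Δ`, `(C*) p·n((1−r₂)s₁m₁+(1−r₁)s₂m₂) ≥ (1−p(1−W₁₂)−npW₁₂)Δ`,
`m_i = (1−p)(1−r₁r₂) + p(1−r_i)`, `Δ = (1−p)² − s₁s₂ > 0`); in the small-`p` limit with `n = s/p` this is `s ≥ 1/(1−r²)` (symmetric `r`) instead of
crowd's `s ≥ 1/(1−r)²`.  `Gate3.arith_crowdplus` is the pure-real statement (witness form) in the format of the cover lemma;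
`Quant.farLayerOne_of_gate3_crowdplus` the row on every graph.
[cite: KozmaNitzan2024, Conjecture 3 (p. 15)]; [cite: Grimmett1999, §1.3 p. 10, §2.2]; [this work].
-/

noncomputable section

namespace Summit.CriticalPhenomena.PercolationContinuityZ3.Theorems

namespace Quant

open Finset MeasureTheory Set
open Literature.Probability.LatticeModels
open Literature.Probability.Percolation
open Bundle (offZ)
open scoped Classical



variable {n : ℕ}

/-- **FAR at layer one for the degree-three gate in the CROWD-PLUS regime** (witness form): if `A` holds `n ≥ 1` relays besides
`v, u₁, u₂` and reals `l1, l2 ≥ 0` satisfy the four cell conditions (`a1`, `c1`, `b10`, `b20`) at `p = w(o,v)`, `rᵢ = w(v,uᵢ)`, then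
the cuts alone give the row (no mean hypothesis, no Harris, any graph).  `l1 = l2 = 0` is file XIV. [this work] -/
theorem farLayerOne_of_gate3_crowdplus (w : Sym2 (Fin n) → unitInterval) (A : Finset (Fin n)) {o v u₁ u₂ : Fin n}
    (hov : o ≠ v) (h1v : u₁ ≠ v) (h2v : u₂ ≠ v) (ho1 : o ≠ u₁) (ho2 : o ≠ u₂) (h12 : u₁ ≠ u₂)
    (hvA : v ∈ A) (h1A : u₁ ∈ A) (h2A : u₂ ∈ A)
    (hw : ∀ z : Fin n, z ≠ o → z ≠ u₁ → z ≠ u₂ → z ≠ v → (w s(v, z) : ℝ) = 0)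
    (hn : 1 ≤ ((((A.erase v).erase u₁).erase u₂).card : ℝ)) (l1 l2 : ℝ) (hl1 : 0 ≤ l1) (hl2 : 0 ≤ l2)
    (hA : 1 - (w s(o, v) : ℝ) * max (w s(v, u₁) : ℝ) (w s(v, u₂) : ℝ) - ((((A.erase v).erase u₁).erase u₂).card : ℝ) * ((w s(o, v) : ℝ) * (1 - max (w s(v, u₁) : ℝ) (w s(v, u₂) : ℝ)))
      ≤ (w s(o, v) : ℝ) * (l1 * (1 - (w s(v, u₁) : ℝ)) + l2 * (1 - (w s(v, u₂) : ℝ))))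
    (hC : 1 - (w s(o, v) : ℝ) * (1 - (1 - (w s(v, u₁) : ℝ)) * (1 - (w s(v, u₂) : ℝ))) - ((((A.erase v).erase u₁).erase u₂).card : ℝ) * ((w s(o, v) : ℝ) * ((1 - (w s(v, u₁) : ℝ)) * (1 - (w s(v, u₂) : ℝ))))
      ≤ (w s(o, v) : ℝ) * ((1 - (w s(v, u₁) : ℝ)) * (1 - (w s(v, u₂) : ℝ))) * (l1 + l2))
    (hB1 : l1 * ((1 - (w s(o, v) : ℝ)) * (1 - (w s(v, u₁) : ℝ))) ≤ (1 - (w s(v, u₂) : ℝ)) * (1 - (1 - (w s(o, v) : ℝ)) * (1 - (w s(v, u₁) : ℝ))) * (l2 + ((((A.erase v).erase u₁).erase u₂).card : ℝ)))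
    (hB2 : l2 * ((1 - (w s(o, v) : ℝ)) * (1 - (w s(v, u₂) : ℝ))) ≤ (1 - (w s(v, u₁) : ℝ)) * (1 - (1 - (w s(o, v) : ℝ)) * (1 - (w s(v, u₂) : ℝ))) * (l1 + ((((A.erase v).erase u₁).erase u₂).card : ℝ)))
    (t : ℝ) (hcut : ∀ a ∈ A, (prodBernoulli w).real (openConn o a : Set (BondConfig (Fin n)))ᶜ ≤ t) :
    (prodBernoulli w).real {ω : BondConfig (Fin n) | (A.filter fun a => ω ∈ openConn o a).card ≤ 1} ≤ t :=
  farLayerOne_of_gate3_of_cover_nomean w A hov h1v h2v ho1 ho2 h12 hvA h1A h2A hw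
    (Gate3.arith_crowdplus (w s(o, v) : ℝ) (w s(v, u₁) : ℝ) (w s(v, u₂) : ℝ) ((((A.erase v).erase u₁).erase u₂).card : ℝ) l1 l2
      (w s(o, v)).2.1 (w s(o, v)).2.2 (w s(v, u₁)).2.1 (w s(v, u₁)).2.2 (w s(v, u₂)).2.1 (w s(v, u₂)).2.2
      hn hl1 hl2 hA hC hB1 hB2) t hcut

end Quant

end Summit.CriticalPhenomena.PercolationContinuityZ3.Theorems
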